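import Literature.NumberTheory.EllipticCurves.KubertTateSevenNormalForm
import Literature.NumberTheory.EllipticCurves.BSDpVariableChangeProofs
import Literature.NumberTheory.EllipticCurves.IwasawaLeadingTermProofs
import HarnessLib

/-!
# Every elliptic curve over `ℚ` with a rational point of order `7` is an `E_{m,n}` (integral Kubert–Tate model)

PROOF-ONLY file (theorems only), topic `NumberTheory/EllipticCurves`; sequel of `KubertTateSevenNormalForm`
(every marked curve with a point of order `7` is an `E(d·d·(d−1), d(d−1))`, Kubert 1976 Table 3, `N = 7`)
and `KubertTateSeven` (the integral model `kubertTateSeven m n` is the scaling `u = n⁻²` of that curve at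
`d = m/n`). Over `ℚ` the two combine, with `d = m/n` in lowest terms:

* **`exists_variableChange_eq_kubertTateSeven_of_addOrderOf_eq_seven`** — for an elliptic (indeed any
  Weierstrass) curve `W/ℚ` and a point `P ∈ W(ℚ)` of order `7` there are COPRIME integers `m, n` with
  `m ≠ 0`, `n ≠ 0`, `m ≠ n` and an admissible change of variables `C` over `ℚ` with
  `C • W = E_{m,n} = [n² + mn − m², m²n(n−m), m²n³(n−m), 0, 0]`;
* `shaCorank_eq_zero_iff_of_smul_eq`, `mordellWeilRank_eq_of_smul_eq` — `t_p` vanishing and the Mordell–Weil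
  rank are carried along `C` (tree `finite_primaryComponent_sha_variableChange_iff`,
  `VariableChange.finrank_point_variableChange`);
* **`exists_kubertTateSeven_model`** — hence every elliptic `E/ℚ` with `E(ℚ) ∋ P` of order `7` has a model
  `E_{m,n}` (coprime `m, n`, `mn(m−n) ≠ 0`) with the SAME rank and the same vanishing of every `t_p`: the
  class-wide `7`-descent of `KubertTateSevenMuDescent[Box]` (Fisher 2001) is a statement about ALL elliptic
  curves over `ℚ` with a rational `7`-torsion point.

## References

* [Kubert1976] D. S. Kubert, *Universal bounds on the torsion of elliptic curves*, Proc. London Math. Soc. (3)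
  33 (1976) 193–237, Table 3 (`N = 7`).
* [SilvermanAEC2009] J. H. Silverman, *AEC*, 2nd ed., III.1 Table 3.1, III.3.1(b), X.§4 Rem. 4.1.1.
* [Fisher2001FiveSevenDescent] T. Fisher, JEMS 3 (2001) 169–201, §§1–2.
-/

noncomputable section

open scoped Classical

namespace WeierstrassCurve

open Literature.NumberTheory.EllipticCurves

/-- **Every curve over `ℚ` with a rational point of order `7` is `ℚ`-isomorphic to an integral Kubert–Tate
model `E_{m,n}` with `m, n` coprime, `mn(m − n) ≠ 0`.** [cite: Kubert1976, Table 3 (N = 7)]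
[cite: SilvermanAEC2009, III.1 Table 3.1] -/
theorem exists_variableChange_eq_kubertTateSeven_of_addOrderOf_eq_seven (W : WeierstrassCurve ℚ)
    (P : W.toAffine.Point) (h7 : addOrderOf P = 7) :
    ∃ (m n : ℤ) (C : VariableChange ℚ), C • W = kubertTateSeven (m : ℚ) (n : ℚ) ∧ IsCoprime m n ∧
      m ≠ 0 ∧ n ≠ 0 ∧ m ≠ n := by
  cases P with
  | zero =>
    have h1 : addOrderOf (0 : W.toAffine.Point) = 7 := h7
    rw [addOrderOf_zero] at h1
    omega
  | @some x y h =>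
    obtain ⟨d, C₁, hC₁, -, hd0, hd1, -⟩ :=
      exists_variableChange_eq_kubertTate_diag₇_of_addOrderOf_eq_seven W h h7
    set m : ℤ := d.num with hm
    set n : ℤ := (d.den : ℤ) with hn
    have hn0 : n ≠ 0 := by rw [hn]; exact_mod_cast d.den_ne_zero
    have hn0' : (n : ℚ) ≠ 0 := by exact_mod_cast hn0
    have hd : d = (m : ℚ) / (n : ℚ) := by rw [hm, hn]; exact (Rat.num_div_den d).symm
    have hm0 : m ≠ 0 := by
      intro h0
      apply hd0
      rw [hd, h0, Int.cast_zero, zero_div]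
    have hmn : m ≠ n := by
      intro h1
      apply hd1
      rw [hd, h1, div_self hn0']
    have hcop : IsCoprime m n := by
      rw [hm, hn, Int.isCoprime_iff_gcd_eq_one]
      exact_mod_cast d.reduced
    set C₂ : VariableChange ℚ := ⟨(Units.mk0 ((n : ℚ) ^ 2) (pow_ne_zero 2 hn0'))⁻¹, 0, 0, 0⟩ with hC₂
    refine ⟨m, n, C₂ * C₁, ?_, hcop, hm0, hn0, hmn⟩
    rw [mul_smul, hC₁, kubertTateSeven_eq_variableChange_kubertTate hn0', ← hd]

/-- `t_p` vanishing is carried along an admissible change of variables: if `C • W = V` then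
`t_p(W) = 0 ↔ t_p(V) = 0` (`Ш[p^∞]` finite on one side iff on the other, tree
`finite_primaryComponent_sha_variableChange_iff`). [cite: SilvermanAEC2009, X.§4 Rem. 4.1.1] -/
theorem shaCorank_eq_zero_iff_of_smul_eq (W V : WeierstrassCurve ℚ) [W.IsElliptic] [V.IsElliptic]
    (C : VariableChange ℚ) (hC : C • W = V) (p : ℕ) [Fact p.Prime] :
    W.shaCorank p = 0 ↔ V.shaCorank p = 0 := by
  subst hC
  rw [← finite_primaryComponent_sha_iff_shaCorank_eq_zero (C • W) p,
    ← finite_primaryComponent_sha_iff_shaCorank_eq_zero W p]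
  exact (finite_primaryComponent_sha_variableChange_iff W C p).symm

/-- The Mordell–Weil rank is carried along an admissible change of variables: if `C • W = V` then
`rank W(ℚ) = rank V(ℚ)` (tree `VariableChange.finrank_point_variableChange`). [cite: SilvermanAEC2009, III.3.1(b)] -/
theorem mordellWeilRank_eq_of_smul_eq (W V : WeierstrassCurve ℚ) (C : VariableChange ℚ) (hC : C • W = V) :
    W.mordellWeilRank = V.mordellWeilRank := by
  subst hC
  exact (@VariableChange.finrank_point_variableChange ℚ _ W C (Classical.decEq ℚ)).symm

/-- **Every elliptic curve over `ℚ` with a rational point of order `7` has an integral Kubert–Tate model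
`E_{m,n}` (`m, n` coprime, `mn(m−n) ≠ 0`) with the same Mordell–Weil rank and the same vanishing of
`t_p = corank_{ℤ_p} Ш[p^∞]` at every prime `p`** — so the class-wide `7`-descent on the family `E_{m,n}`
(`KubertTateSevenMuDescent`, `KubertTateSevenMuDescentBox`) speaks about every such curve.
[cite: Kubert1976, Table 3 (N = 7)] [cite: Fisher2001FiveSevenDescent, §§1–2] -/
theorem exists_kubertTateSeven_model (W : WeierstrassCurve ℚ) [W.IsElliptic] (P : W.toAffine.Point)
    (h7 : addOrderOf P = 7) :
    ∃ (m n : ℤ) (_ : (kubertTateSeven (m : ℚ) (n : ℚ)).IsElliptic), IsCoprime m n ∧ m ≠ 0 ∧ n ≠ 0 ∧ m ≠ n ∧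
      W.mordellWeilRank = (kubertTateSeven (m : ℚ) (n : ℚ)).mordellWeilRank ∧
      ∀ (p : ℕ) [Fact p.Prime], W.shaCorank p = 0 ↔ (kubertTateSeven (m : ℚ) (n : ℚ)).shaCorank p = 0 := by
  obtain ⟨m, n, C, hC, hcop, hm0, hn0, hmn⟩ :=
    exists_variableChange_eq_kubertTateSeven_of_addOrderOf_eq_seven W P h7
  haveI hE : (kubertTateSeven (m : ℚ) (n : ℚ)).IsElliptic := by rw [← hC]; infer_instance
  exact ⟨m, n, hE, hcop, hm0, hn0, hmn, mordellWeilRank_eq_of_smul_eq W _ C hC,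
    fun p _ ↦ shaCorank_eq_zero_iff_of_smul_eq W _ C hC p⟩

end WeierstrassCurve

end
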